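import Summits.Ventures.AbcSig.Conjectures.LevelRaising32L2Instance313Sympl
import Summits.Ventures.AbcSig.Levels.N10016QCurve
import Literature.NumberTheory.EllipticCurves.QuadraticTwist
import Mathlib.AlgebraicGeometry.EllipticCurve.DivisionPolynomial.Basic

/-!
# Venture AbcSig — Frey-side 2-ADIC local data of `E₁(S)` and the `(1+i)`-adic valuations of the curve of record (PROVED)

HONEST FRAMING. Support file of the computation cell `pub-abcsig` (p-lean g22; lead g20 = registrar; keyed line «E7-L313-INERTIA2»: registrar
l.109–l.111, THEORY NOTE HOME/lead/inertia2-lead-g20/THEORY-INERTIA2-lead-g20.md §1–§7 + ADDENDUM §8–§9, referee audit HOME/referee/ref-g92/).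
Companion of `Conjectures/L313FreyLocalData.lean` (p543565: the places `313`, `223`). **ARITHMETIC ONLY: this file PROVES, for every putative
datum at once, the Frey-side INPUTS at the prime `2` that the INERTIA2 line feeds into its CITED local theorems ([Kraus 1990, ℓ = 2]: `e = 8`
from the valuation triple; [FK16, Thm. 15(3)] and its tables, parameter `n = v₂(c₆)`; [ST68, §2]) and into its two blind hands' computations
(3-division polynomials), plus the `(1+i)`-adic valuations of the invariants of the ℚ-curve of record `E/ℚ(i)` (`Levels/N10016QCurve.lean`,
p510507). No inertial field, no `G₃`, no inducing field `K₀`, no reduction type over any extension, no twist sign is computed or claimed here —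
those are the hands' deliverables (E)/(F)/(G), COMPUTED ≠ PROVED. Kernel face of `CONJ_LR32_L2` UNCHANGED (62 PROVED + 1 REDUCED + 1 OOS /
64); no statement of record touched; Q(313; 23) NOT decided; typed ≠ proved; computed ≠ proved; no row of the paper; nothing about ABC.**

WHAT IS PROVED (no hypothesis beyond those displayed in each signature; labels in the cell's words).
* (A1) 2-ADIC SIGNATURE. For every `S = (A, B, C; n; a, b, c)` in BS04 case (i) as printed (`FreyCase.i.Holds`: `abABC` odd, `4 ∣ b + BC`
  [BS04, pp. 26–27]) with `A aⁿ + B bⁿ = C c²`: `c` is EVEN (`caseI_two_dvd_c`); for `n` odd, `a ≡ AC (mod 4)` and `D := BC·bⁿ ≡ 3 (mod 4)`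
  (`caseI_mod_four`, `caseI_mod_four_int`); `c₆(E₁(S)) = −2⁶·cC·(8c²C² − 9D)` (`e1CurveInt_c₆`; the tree has `c₄ = 2⁴·(4c²C² − 3D)`,
  `Δ = 2⁶·C³B²A(ab²)ⁿ`); `c̃₄ := 4c²C² − 3D ≡ −3D (mod 16)` (`caseI_c₄_red_mod_sixteen`); **`caseI_two_adic_signature`:
  `(v₂(c₄), v₂(c₆), v₂(Δ)) = (4, 6 + v₂(c), 6)`, `v₂(c) ≥ 1`** — the signature `(4, ≥ 7, 6)` of THEORY §1 (S1) for EVERY admissible class,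
  with [FK16]'s table parameter `n = v₂(c₆) = 6 + v₂(z)` a kernel identity («`k ∈ {1, 2, ≥ 3}` ↔ `n ∈ {7, 8, ≥ 9}`», [FK16, p. 48]);
  `lr32E1Datum_caseI_two_adic`: the same for the `E₁` data of the open instance `(313; 23)` (`LR32E1Datum`), where `a ≡ 1 (mod 4)` in BOTH
  orientations (`313 ≡ 1 (mod 4)`; ADDENDUM (U1)). CITED, NOT FORMALISED: minimality at `2` (`v₂(Δ) = 6 < 12`, [Sil09, VII.1]);
  `e(E₁/ℚ₂) = 8` ([Kraus 1990]); `v₂(N(E₁)) = 5` ([BS04, Lemma 2.1(b)]).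
* (A2) `c ↦ −c` (THEORY (Q-a); ADDENDUM (T3), reading (r2); referee (F3)). `e1Curve_negC_eq_quadraticTwist`: over `ℚ`, **`E₁(a, b, −c)` IS the
  quadratic twist of `E₁(a, b, c)` by `−1`** on the nose (Literature model `WeierstrassCurve.quadraticTwist`; that this is `⊗ χ₋₄` on the
  Galois side is the standard dictionary, CITED); `e1CurveInt_negC_gaussianInt`: over `ℤ[i] ⊂ K_v = ℚ₂(i)`, **`E₁(a, b, −c) = ⟨i⁻¹, 0, 0, 0⟩ •
  E₁(a, b, c)`** (Mathlib variable change, an ISOMORPHISM over `ℤ[i]`) — both `c`-orientations of a class give `K_v`-isomorphic curves: the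
  kernel form of «`c ↦ −c` does not flip `i(E₁)`».
* (A3) THE CM LIMIT AND ITS `⊗ μ` PARTNER (ADDENDUM (U2); registrar l.111 P30(b)). `cmCurve D : Y² = X³ + D·X` (signature `(4, ∞, 6)` for
  `D` odd, `cmCurve_two_adic`); `e1CurveInt_congr_cmCurve` (`E₁(S) ≡ E₀(BC·bⁿ)` coefficientwise modulo `2^{v₂(c)+1}`); `cmCurve_quadraticTwist`
  (over `ℚ`, `E₀(D)^{(d)} = E₀(d²D)` on the nose — so **`E₀(9D)` is the twist of `E₀(D)` by `−3`**; `ℚ₂(√−3)/ℚ₂` UNRAMIFIED is CITED: «`D ↦ 9D`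
  = `⊗ μ`» is the DERIVED reading of a kernel identity); `cmCurve_nine_eq_smul`; `e1Curve_quadraticTwist_neg_three`; `zmod16_nine_table`
  (`(9b)²³ ≡ 9·b²³ (mod 16)`, `b ↦ 9b` a fixed-point-free involution of the odd residues: the bookkeeping behind «exactly HALF of the classes
  `b mod 16`»; the bit itself is deliverable (G), COMPUTED).
* (A4) THE CURVE OF RECORD `E` AT `v = (1+i)` (extends RECORD `L313QCurve`: `E_c₄`, `E_c₆`, `E_Δ`). `E_two_adic_factorizations`;
  **`E_two_adic_valuations`: `(v(c₄), v(c₆), v(Δ)) = (8, 15, 12)` at `v`, exactly**; `E_two_adic_j`: `v(c₄³) = 24`, so `v(j(E)) = 24 − 12 =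
  12 ≥ 0` — `j(E)` integral at `v` ⇒ POTENTIALLY GOOD reduction at `v` ([Sil09, VII.5.5], CITED for this implication), `3 ∣ v(Δ)` (the
  registrar's «`3 ∤ e(E/K_v)`» input, ADDENDUM (T1)); minimality at `v`, Kodaira `I₂*`, `f_v = 6` remain the engines' CHECK X (NOT claimed).
  `e1CurveInt_Ψ₃`, `E_Ψ₃`: the 3-division polynomials `3X⁴ + 8cC·X³ + 6D·X² − D²` and `3X⁴ + 4a₂X³ + 6a₄X² − a₄²` (Mathlib
  `WeierstrassCurve.Ψ₃`) — the two hands' input polynomials for `G₃`, as kernel identities.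

WHAT THIS IS NOT. No local field, inertia group, conductor exponent, inertial or symplectic type is formalised (Mathlib has no `ℚ₂(i)`-adic
reduction theory, no `E[p]` Galois modules, no Weil pairing over number fields); every arrow from the PROVED arithmetic to «`e = 8`»,
«potentially good», «inertial field `F_{g_j}`», «`K₀ ∈ {ℚ₂(i), ℚ₂(√3)}`», «twist sign» is CITED or is the hands' COMPUTATION. Not a proof or
refutation of `CONJ_LR32_L2At M 313`, `LR32Residual313E`, `LR32Residual313Sympl` (all OPEN); statements of record untouched; not a decision of
Q(313; 23); no row; nothing about ABC or any summit. References: [BS04] M. A. Bennett, C. M. Skinner, Canad. J. Math. 56 (2004) 23–54, pp. 26–27,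
Lemma 2.1; [Kraus 1990] A. Kraus, Manuscripta Math. 69 (1990) 353–385 (`ℓ = 2`); [FK16] N. Freitas, A. Kraus, Mem. Amer. Math. Soc. 277 (2022)
no. 1361 (arXiv:1607.01218), Thm. 15(3), p. 48; [ST68] J.-P. Serre, J. Tate, Ann. of Math. 88 (1968) 492–517, §2; [Sil09] J. H. Silverman, *The
Arithmetic of Elliptic Curves*, VII.1, VII.5.5, X.2/X.5. Cell records: HOME = run/shared/lean/pub/pub-abcsig/: lead/inertia2-lead-g20/,
referee/ref-g92/, lit/ (lit g34 pins), plean/g21/README-g21.md, plean/g22/README-g22.md.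
-/

namespace Summit.Ventures.AbcSig.Conjectures

open Summit.Ventures.AbcSig

/-! ## Small arithmetic helpers (2-adic valuations, parities, residues mod 4) -/

/-- `v₂(2ʲ·x) = j + v₂(x)` for `x ≠ 0`. -/
theorem padicValInt_two_pow_mul {x : ℤ} (hx : x ≠ 0) (j : ℕ) :
    padicValInt 2 (2 ^ j * x) = j + padicValInt 2 x := by
  have h2 : ((2 : ℤ) ^ j).natAbs = 2 ^ j := by rw [Int.natAbs_pow]; rfl
  rw [padicValInt.mul (pow_ne_zero _ two_ne_zero) hx, padicValInt, h2, padicValNat.prime_pow]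

/-- `¬ 2 ∣ x ↔ Odd x` over `ℤ`. -/
theorem not_two_dvd_iff_odd {x : ℤ} : ¬ (2 : ℤ) ∣ x ↔ Odd x := by
  rw [← even_iff_two_dvd, Int.not_even_iff_odd]

/-- Residues mod `4`: an odd integer is `1` or `3`, an even one `0` or `2` in `ZMod 4`. -/
theorem intCast_zmod4_cases (x : ℤ) :
    (¬ (2 : ℤ) ∣ x → (x : ZMod 4) = 1 ∨ (x : ZMod 4) = 3) ∧ ((2 : ℤ) ∣ x → (x : ZMod 4) = 0 ∨ (x : ZMod 4) = 2) := by
  rw [← ZMod.intCast_mod x 4, Nat.cast_ofNat]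
  constructor <;> intro hx
  · rcases (show x % 4 = 1 ∨ x % 4 = 3 by omega) with h | h <;> rw [h] <;> decide
  · rcases (show x % 4 = 0 ∨ x % 4 = 2 by omega) with h | h <;> rw [h] <;> decide

/-- Odd powers of odd residues mod `4`: `uⁿ = u`. -/
theorem zmod4_pow_odd (u : ZMod 4) (hu : u = 1 ∨ u = 3) {n : ℕ} (hn : Odd n) : u ^ n = u := by
  rcases hu with rfl | rfl
  · exact one_pow n
  · rw [show (3 : ZMod 4) = -1 by decide, hn.neg_one_pow]

/-- Kernel table behind `caseI_mod_four`: for odd `A, B, C, a, b` and even `c` with `A a + B b = C c²` and `b + BC = 0` in `ZMod 4`,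
`a = AC` and `BC·b = 3`. -/
theorem zmod4_caseI_table : ∀ A B C a b c : ZMod 4, (A = 1 ∨ A = 3) → (B = 1 ∨ B = 3) → (C = 1 ∨ C = 3) →
    (a = 1 ∨ a = 3) → (b = 1 ∨ b = 3) → (c = 0 ∨ c = 2) → A * a + B * b = C * c ^ 2 → b + B * C = 0 →
    a = A * C ∧ B * C * b = 3 := by
  decide

/-! ## (A1) The 2-adic invariants and signature of `E₁(S)` in BS04 case (i) -/

/-- **`c₆(E₁(S)) = −2⁶·cC·(8c²C² − 9·BC bⁿ)`** (from `b₂ = 8cC`, `b₄ = 2·BC bⁿ`, `b₆ = 0`; companion of the tree's `e1CurveInt_c₄`,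
`e1CurveInt_Δ`). -/
theorem e1CurveInt_c₆ (S : FreyDatum) :
    (e1CurveInt S).c₆ = -(64 * (S.c * (S.C : ℤ)) * (8 * (S.c * (S.C : ℤ)) ^ 2 - 9 * ((S.B : ℤ) * S.C * S.b ^ S.n))) := by
  simp only [e1CurveInt, WeierstrassCurve.c₆, WeierstrassCurve.b₂, WeierstrassCurve.b₄, WeierstrassCurve.b₆]
  ring

/-- In case (i) (`¬ 2 ∣ abABC`): `a`, `b`, `A`, `B`, `C` are odd. -/
theorem caseI_odd (S : FreyDatum) (hcase : FreyCase.i.Holds S.A S.B S.C S.n S.a S.b S.c) :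
    ¬ (2 : ℤ) ∣ S.a ∧ ¬ (2 : ℤ) ∣ S.b ∧ ¬ (2 : ℤ) ∣ (S.A : ℤ) ∧ ¬ (2 : ℤ) ∣ (S.B : ℤ) ∧ ¬ (2 : ℤ) ∣ (S.C : ℤ) := by
  obtain ⟨hodd, -⟩ := hcase
  refine ⟨fun h => hodd ?_, fun h => hodd ?_, fun h => hodd ?_, fun h => hodd ?_, fun h => hodd ?_⟩
  · exact (((h.mul_right _).mul_right _).mul_right _).mul_right _
  · exact (((h.mul_left _).mul_right _).mul_right _).mul_right _
  · exact ((Dvd.dvd.mul_left h _).mul_right _).mul_right _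
  exacts [(Dvd.dvd.mul_left h _).mul_right _, Dvd.dvd.mul_left h _]

/-- **In case (i), `c` is even** (`C c² = A aⁿ + B bⁿ` is odd + odd): `k := v₂(c) ≥ 1`, cf. `caseI_two_adic_signature`. -/
theorem caseI_two_dvd_c (S : FreyDatum) (hcase : FreyCase.i.Holds S.A S.B S.C S.n S.a S.b S.c)
    (heq : (S.A : ℤ) * S.a ^ S.n + S.B * S.b ^ S.n = S.C * S.c ^ 2) : (2 : ℤ) ∣ S.c := by
  obtain ⟨ha, hb, hA, hB, hC⟩ := caseI_odd S hcase
  have h1 : Odd ((S.A : ℤ) * S.a ^ S.n) := (not_two_dvd_iff_odd.mp hA).mul (not_two_dvd_iff_odd.mp ha).pow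
  have h2 : Odd ((S.B : ℤ) * S.b ^ S.n) := (not_two_dvd_iff_odd.mp hB).mul (not_two_dvd_iff_odd.mp hb).pow
  have h3 : Even ((S.C : ℤ) * S.c ^ 2) := heq ▸ h1.add_odd h2
  rcases Int.even_mul.mp h3 with h | h
  · exact absurd (even_iff_two_dvd.mp h) hC
  · exact even_iff_two_dvd.mp (Int.even_pow.mp h).1

/-- **Residues mod 4 in case (i)** (`n` odd): `a ≡ AC (mod 4)` and `D = BC·bⁿ ≡ 3 (mod 4)` — from `c` even (`C c² ≡ 0`), `xⁿ ≡ x` for odd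
`x`, and the printed normalisation `b ≡ −BC (mod 4)`; kernel table `zmod4_caseI_table`. (So `c̃₄ = 4c²C² − 3D ≡ −3D ≡ −1 (mod 4)`:
engine-2 g15's 2-adic reading, now PROVED.) -/
theorem caseI_mod_four (S : FreyDatum) (hcase : FreyCase.i.Holds S.A S.B S.C S.n S.a S.b S.c) (hn : Odd S.n)
    (heq : (S.A : ℤ) * S.a ^ S.n + S.B * S.b ^ S.n = S.C * S.c ^ 2) :
    (S.a : ZMod 4) = (S.A : ZMod 4) * (S.C : ZMod 4) ∧ (((S.B : ℤ) * S.C * S.b ^ S.n : ℤ) : ZMod 4) = 3 := by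
  obtain ⟨ha, hb, hA, hB, hC⟩ := caseI_odd S hcase; have hc := caseI_two_dvd_c S hcase heq
  have h4 : ((S.b + S.B * S.C : ℤ) : ZMod 4) = 0 := (ZMod.intCast_zmod_eq_zero_iff_dvd _ 4).mpr hcase.2
  have heq' := congrArg (Int.cast : ℤ → ZMod 4) heq
  push_cast at h4 heq' ⊢
  have hA' := (intCast_zmod4_cases _).1 hA; have hB' := (intCast_zmod4_cases _).1 hB; have hC' := (intCast_zmod4_cases _).1 hC
  have ha' := (intCast_zmod4_cases _).1 ha; have hb' := (intCast_zmod4_cases _).1 hb; have hc' := (intCast_zmod4_cases _).2 hc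
  push_cast at hA' hB' hC'
  rw [zmod4_pow_odd _ ha' hn, zmod4_pow_odd _ hb' hn] at heq'
  rw [zmod4_pow_odd _ hb' hn]; exact zmod4_caseI_table _ _ _ _ _ _ hA' hB' hC' ha' hb' hc' heq' h4

/-- The same residues as integer divisibilities: `4 ∣ a − AC` and `4 ∣ D + 1`, `D = BC·bⁿ`. -/
theorem caseI_mod_four_int (S : FreyDatum) (hcase : FreyCase.i.Holds S.A S.B S.C S.n S.a S.b S.c) (hn : Odd S.n)
    (heq : (S.A : ℤ) * S.a ^ S.n + S.B * S.b ^ S.n = S.C * S.c ^ 2) :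
    (4 : ℤ) ∣ S.a - S.A * S.C ∧ (4 : ℤ) ∣ (S.B : ℤ) * S.C * S.b ^ S.n + 1 := by
  obtain ⟨h1, h2⟩ := caseI_mod_four S hcase hn heq
  constructor
  · exact_mod_cast (ZMod.intCast_eq_intCast_iff_dvd_sub (S.A * S.C : ℤ) S.a 4).mp (by push_cast; exact h1.symm)
  · exact_mod_cast (ZMod.intCast_zmod_eq_zero_iff_dvd ((S.B : ℤ) * S.C * S.b ^ S.n + 1) 4).mp (by push_cast at h2 ⊢; rw [h2]; decide)

/-- `c̃₄ := c₄/2⁴ = 4c²C² − 3D ≡ −3D (mod 16)` in case (i) (`c` even). -/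
theorem caseI_c₄_red_mod_sixteen (S : FreyDatum) (hcase : FreyCase.i.Holds S.A S.B S.C S.n S.a S.b S.c)
    (heq : (S.A : ℤ) * S.a ^ S.n + S.B * S.b ^ S.n = S.C * S.c ^ 2) :
    (16 : ℤ) ∣ (4 * (S.c * (S.C : ℤ)) ^ 2 - 3 * ((S.B : ℤ) * S.C * S.b ^ S.n)) + 3 * ((S.B : ℤ) * S.C * S.b ^ S.n) := by
  obtain ⟨t, ht⟩ := caseI_two_dvd_c S hcase heq
  exact ⟨t ^ 2 * (S.C : ℤ) ^ 2, by rw [ht]; ring⟩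

/-- **THE 2-ADIC SIGNATURE OF `E₁(S)` IN CASE (i), PROVED: `(v₂(c₄), v₂(c₆), v₂(Δ)) = (4, 6 + v₂(c), 6)` and `v₂(c) ≥ 1`** — the
signature `(4, ≥ 7, 6)` of THEORY-INERTIA2 §1 (S1) for every admissible class at once (`c₄ = 2⁴·(odd)`, `c₆ = −2⁶·c·(odd)`,
`Δ = 2⁶·(odd)` by `caseI_odd` / `caseI_two_dvd_c`). [FK16]'s table parameter is `n = v₂(c₆) = 6 + v₂(z)`. CITED consequences (not
formalised): the model is minimal at `2` (`v₂(Δ) < 12`); `e(E₁/ℚ₂) = 8` [Kraus 1990, `ℓ = 2`]; `v₂(N(E₁)) = 5` [BS04, Lemma 2.1(b)]. -/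
theorem caseI_two_adic_signature (S : FreyDatum) (hcase : FreyCase.i.Holds S.A S.B S.C S.n S.a S.b S.c)
    (heq : (S.A : ℤ) * S.a ^ S.n + S.B * S.b ^ S.n = S.C * S.c ^ 2) (hc0 : S.c ≠ 0) :
    padicValInt 2 (e1CurveInt S).c₄ = 4 ∧ padicValInt 2 (e1CurveInt S).c₆ = 6 + padicValInt 2 S.c ∧
      padicValInt 2 (e1CurveInt S).Δ = 6 ∧ 1 ≤ padicValInt 2 S.c := by
  obtain ⟨ha, hb, hA, hB, hC⟩ := caseI_odd S hcase; have hc := caseI_two_dvd_c S hcase heq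
  have hD : ¬ (2 : ℤ) ∣ (S.B : ℤ) * S.C * S.b ^ S.n :=
    not_two_dvd_iff_odd.mpr (((not_two_dvd_iff_odd.mp hB).mul (not_two_dvd_iff_odd.mp hC)).mul (not_two_dvd_iff_odd.mp hb).pow)
  obtain ⟨hX, hY⟩ : ¬ (2 : ℤ) ∣ 4 * (S.c * (S.C : ℤ)) ^ 2 - 3 * ((S.B : ℤ) * S.C * S.b ^ S.n) ∧
      ¬ (2 : ℤ) ∣ 8 * (S.c * (S.C : ℤ)) ^ 2 - 9 * ((S.B : ℤ) * S.C * S.b ^ S.n) := by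
    generalize (S.c * (S.C : ℤ)) ^ 2 = t at *
    generalize (S.B : ℤ) * S.C * S.b ^ S.n = D at *
    omega
  have hZ : ¬ (2 : ℤ) ∣ (S.C : ℤ) ^ 3 * (S.B : ℤ) ^ 2 * S.A * (S.a ^ S.n * (S.b ^ S.n) ^ 2) :=
    not_two_dvd_iff_odd.mpr (((((not_two_dvd_iff_odd.mp hC).pow).mul (not_two_dvd_iff_odd.mp hB).pow).mul
      (not_two_dvd_iff_odd.mp hA)).mul ((not_two_dvd_iff_odd.mp ha).pow.mul (not_two_dvd_iff_odd.mp hb).pow.pow))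
  have hne : ∀ {x : ℤ}, ¬ (2 : ℤ) ∣ x → x ≠ 0 := fun h h0 => h (h0 ▸ dvd_zero 2)
  refine ⟨?_, ?_, ?_, ?_⟩
  · rw [e1CurveInt_c₄, show (16 : ℤ) = 2 ^ 4 from rfl, padicValInt_two_pow_mul (hne hX), padicValInt.eq_zero_of_not_dvd hX]
  · have hrw : (e1CurveInt S).c₆ =
        2 ^ 6 * (S.c * -((S.C : ℤ) * (8 * (S.c * (S.C : ℤ)) ^ 2 - 9 * ((S.B : ℤ) * S.C * S.b ^ S.n)))) := by
      rw [e1CurveInt_c₆]; ring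
    have hW : ¬ (2 : ℤ) ∣ -((S.C : ℤ) * (8 * (S.c * (S.C : ℤ)) ^ 2 - 9 * ((S.B : ℤ) * S.C * S.b ^ S.n))) := by
      rw [dvd_neg]
      exact not_two_dvd_iff_odd.mpr ((not_two_dvd_iff_odd.mp hC).mul (not_two_dvd_iff_odd.mp hY))
    rw [hrw, padicValInt_two_pow_mul (mul_ne_zero hc0 (hne hW)), padicValInt.mul hc0 (hne hW),
      padicValInt.eq_zero_of_not_dvd hW, add_zero]
  · have hrw : (e1CurveInt S).Δ = 2 ^ 6 * ((S.C : ℤ) ^ 3 * (S.B : ℤ) ^ 2 * S.A * (S.a ^ S.n * (S.b ^ S.n) ^ 2)) := by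
      rw [e1CurveInt_Δ_eq S heq]; ring
    rw [hrw, padicValInt_two_pow_mul (hne hZ), padicValInt.eq_zero_of_not_dvd hZ]
  · have h2 : ((2 : ℕ) : ℤ) ^ 1 ∣ S.c := by rw [pow_one]; exact_mod_cast hc
    exact ((padicValInt_dvd_iff 1 S.c).mp h2).resolve_left hc0

/-- Corollary: `v₂(c₆(E₁(S))) ≥ 7` — the printed hypothesis «`(v₂(c₄), v₂(c₆), v₂(Δ)) = (4, ≥ 7, 6)`» of [Kraus 1990] / [FK16]. -/
theorem caseI_seven_le_val_c₆ (S : FreyDatum) (hcase : FreyCase.i.Holds S.A S.B S.C S.n S.a S.b S.c)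
    (heq : (S.A : ℤ) * S.a ^ S.n + S.B * S.b ^ S.n = S.C * S.c ^ 2) (hc0 : S.c ≠ 0) : 7 ≤ padicValInt 2 (e1CurveInt S).c₆ := by
  obtain ⟨-, h6, -, hk⟩ := caseI_two_adic_signature S hcase heq hc0; omega

/-- **The `E₁` data of the open instance `(313; 23)` in case (i)** (`LR32E1Datum S m`: `n = 23`, `C = 1`, `gcd(A, B) = 1`, `A·B = 313^m`,
primitive; plus the printed case-(i) condition `ab` odd, `4 ∣ b + B`): the signature `(4, 6 + v₂(c), 6)` with `v₂(c) ≥ 1`, and the residues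
`a ≡ 1 (mod 4)` (in BOTH orientations, as `A ∈ {1, 313^m}` and `313 ≡ 1 (mod 4)` — ADDENDUM (U1)) and `D = B·b²³ ≡ 3 (mod 4)`. -/
theorem lr32E1Datum_caseI_two_adic (S : FreyDatum) (m : ℕ) (hS : LR32E1Datum S m)
    (hcase : FreyCase.i.Holds S.A S.B S.C S.n S.a S.b S.c) :
    (padicValInt 2 (e1CurveInt S).c₄ = 4 ∧ padicValInt 2 (e1CurveInt S).c₆ = 6 + padicValInt 2 S.c ∧
      padicValInt 2 (e1CurveInt S).Δ = 6 ∧ 1 ≤ padicValInt 2 S.c) ∧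
    (4 : ℤ) ∣ S.a - 1 ∧ (4 : ℤ) ∣ (S.B : ℤ) * S.b ^ 23 + 1 := by
  have heq := hS.eqn
  obtain ⟨hn, hC, -, -, hsol, hAB⟩ := hS
  have hc0 : S.c ≠ 0 := fun h0 => hsol.2.2.2.1 (by rw [h0, mul_zero]); have hn' : Odd S.n := by rw [hn]; decide
  refine ⟨caseI_two_adic_signature S hcase heq hc0, ?_, ?_⟩
  · obtain ⟨h1, -⟩ := caseI_mod_four_int S hcase hn' heq
    obtain ⟨i, -, hi⟩ := (Nat.dvd_prime_pow (by norm_num : Nat.Prime 313)).mp (hAB ▸ Nat.dvd_mul_right S.A S.B)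
    have hA4 : (4 : ℤ) ∣ (S.A : ℤ) * S.C - 1 := by
      rw [hi, hC]; push_cast; rw [mul_one]
      exact Int.ModEq.dvd ((show (313 : ℤ) ≡ 1 [ZMOD 4] by decide).pow i |>.trans (by rw [one_pow])).symm
    simpa [sub_add_sub_cancel] using Dvd.dvd.add h1 hA4
  · obtain ⟨-, h2⟩ := caseI_mod_four_int S hcase hn' heq
    rw [hC, hn] at h2
    simpa using h2

/-! ## (A2) `c ↦ −c`: the quadratic twist by `−1`, an isomorphism over `ℤ[i]` -/

/-- The datum with `c` replaced by `−c` («we are free to replace `c` by `−c`», [BS04, p. 27]; `IsPrimitiveSolution.neg`). -/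
def _root_.Summit.Ventures.AbcSig.FreyDatum.negC (S : FreyDatum) : FreyDatum :=
  ⟨S.A, S.B, S.C, S.n, S.a, S.b, -S.c⟩

/-- **Over `ℚ`, `E₁(a, b, −c)` IS the quadratic twist of `E₁(a, b, c)` by `−1`, on the nose** (Literature model
`WeierstrassCurve.quadraticTwist`: `W^{(d)} = ⟨0, d·b₂/4, 0, d²·b₄/2, d³·b₆/4⟩`; here `b₂ = 8cC`, `b₄ = 2D`, `b₆ = 0`). On the Galois side
the twist by `−1` is `⊗ χ₋₄` (standard dictionary, CITED): reading (r2) of ADDENDUM (T3). -/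
theorem e1Curve_negC_eq_quadraticTwist (S : FreyDatum) :
    (e1CurveInt S.negC).map (Int.castRingHom ℚ) = ((e1CurveInt S).map (Int.castRingHom ℚ)).quadraticTwist (-1) := by
  simp only [WeierstrassCurve.quadraticTwist, WeierstrassCurve.map, e1CurveInt, FreyDatum.negC, WeierstrassCurve.b₂,
    WeierstrassCurve.b₄, WeierstrassCurve.b₆, eq_intCast, WeierstrassCurve.mk.injEq]
  push_cast
  exact ⟨by trivial, by ring, by trivial, by ring, by ring⟩

/-- The unit `i` of `ℤ[i]` (`L313QCurve.gi`, inverse `−i`). -/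
def giUnit : GaussianIntˣ := ⟨L313QCurve.gi, -L313QCurve.gi, by decide, by decide⟩

/-- **Over `ℤ[i] ⊂ K_v = ℚ₂(i)`: `E₁(a, b, −c) = intScale i (E₁(a, b, c)) = ⟨i⁻¹, 0, 0, 0⟩ • E₁(a, b, c)`** (the tree's integral
rescaling `aⱼ ↦ iʲ·aⱼ`, and Mathlib's variable change — an ISOMORPHISM of Weierstrass curves over `ℤ[i]`). Hence both `c`-orientations of an
admissible class define `K_v`-isomorphic curves: every local invariant at `v = (1+i)` (inertial field, `G₃`, `K₀`, reduction over any extension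
of `K_v`) is the same for `c` and `−c` — the kernel form of THEORY (Q-a) / referee (F3) «`c ↦ −c` does not flip `i(E₁)`». -/
theorem e1CurveInt_negC_gaussianInt (S : FreyDatum) :
    (e1CurveInt S.negC).map (Int.castRingHom GaussianInt) =
      L313QCurve.intScale L313QCurve.gi ((e1CurveInt S).map (Int.castRingHom GaussianInt)) ∧
    (e1CurveInt S.negC).map (Int.castRingHom GaussianInt) =
      (⟨giUnit⁻¹, 0, 0, 0⟩ : WeierstrassCurve.VariableChange GaussianInt) • (e1CurveInt S).map (Int.castRingHom GaussianInt) := by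
  have h2 : L313QCurve.gi ^ 2 = -1 := by decide
  have h4 : L313QCurve.gi ^ 4 = 1 := by decide
  have h : (e1CurveInt S.negC).map (Int.castRingHom GaussianInt) =
      L313QCurve.intScale L313QCurve.gi ((e1CurveInt S).map (Int.castRingHom GaussianInt)) := by
    ext <;> simp [e1CurveInt, FreyDatum.negC, L313QCurve.intScale, WeierstrassCurve.map, h2, h4]
  exact ⟨h, h.trans (L313QCurve.intScale_eq_smul giUnit _)⟩

/-! ## (A3) The CM limit `E₀(D) : Y² = X³ + D·X` and its `⊗ μ` partner `E₀(9D)` -/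

/-- The CM curve `E₀(D) : Y² = X³ + D·X` (`j = 1728`, CM by `ℤ[i]`): the 2-adic limit of `E₁(a, b, c)` as `v₂(c) → ∞` (ADDENDUM (U2)). -/
def cmCurve {R : Type*} [CommRing R] (D : R) : WeierstrassCurve R := ⟨0, 0, 0, D, 0⟩

/-- `c₄(E₀(D)) = −48·D`, `c₆(E₀(D)) = 0`, `Δ(E₀(D)) = −64·D³`. -/
theorem cmCurve_invariants {R : Type*} [CommRing R] (D : R) :
    (cmCurve D).c₄ = -48 * D ∧ (cmCurve D).c₆ = 0 ∧ (cmCurve D).Δ = -64 * D ^ 3 := by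
  simp only [cmCurve, WeierstrassCurve.c₄, WeierstrassCurve.c₆, WeierstrassCurve.Δ, WeierstrassCurve.b₂, WeierstrassCurve.b₄,
    WeierstrassCurve.b₆, WeierstrassCurve.b₈]
  exact ⟨by ring, by ring, by ring⟩

/-- For `D` odd: `(v₂(c₄), c₆, v₂(Δ))(E₀(D)) = (4, 0, 6)` — signature `(4, ∞, 6)`, the registrar's reference family (ADDENDUM (T3)). -/
theorem cmCurve_two_adic (D : ℤ) (hD : ¬ (2 : ℤ) ∣ D) :
    padicValInt 2 (cmCurve D).c₄ = 4 ∧ (cmCurve D).c₆ = 0 ∧ padicValInt 2 (cmCurve D).Δ = 6 := by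
  obtain ⟨h4, h6, hΔ⟩ := cmCurve_invariants D
  have hne : ∀ {x : ℤ}, ¬ (2 : ℤ) ∣ x → x ≠ 0 := fun h h0 => h (h0 ▸ dvd_zero 2)
  have h3 : ¬ (2 : ℤ) ∣ -(3 * D) := by omega
  have hD3 : ¬ (2 : ℤ) ∣ -D ^ 3 := by rw [dvd_neg]; exact not_two_dvd_iff_odd.mpr (not_two_dvd_iff_odd.mp hD).pow
  rw [h4, show (-48 : ℤ) * D = 2 ^ 4 * (-(3 * D)) by ring, padicValInt_two_pow_mul (hne h3), padicValInt.eq_zero_of_not_dvd h3, hΔ,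
    show (-64 : ℤ) * D ^ 3 = 2 ^ 6 * (-D ^ 3) by ring, padicValInt_two_pow_mul (hne hD3), padicValInt.eq_zero_of_not_dvd hD3]
  exact ⟨rfl, h6, rfl⟩

/-- **`E₁(S)` is 2-adically close to `E₀(D)`, `D = BC·bⁿ`:** the models agree in `a₁, a₃, a₄, a₆`, and `2^{v₂(c)+1} ∣ a₂(E₁(S)) − a₂(E₀(D))`
(`a₂ = 2cC`). (ADDENDUM (U2): for `v₂(c) ≥ k₀` the local type is that of the CM curve — Krasner/local constancy, CITED, `k₀` TO-COMPUTE.) -/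
theorem e1CurveInt_congr_cmCurve (S : FreyDatum) :
    (e1CurveInt S).a₁ = (cmCurve ((S.B : ℤ) * S.C * S.b ^ S.n)).a₁ ∧ (e1CurveInt S).a₃ = (cmCurve ((S.B : ℤ) * S.C * S.b ^ S.n)).a₃ ∧
    (e1CurveInt S).a₄ = (cmCurve ((S.B : ℤ) * S.C * S.b ^ S.n)).a₄ ∧ (e1CurveInt S).a₆ = (cmCurve ((S.B : ℤ) * S.C * S.b ^ S.n)).a₆ ∧
    (2 : ℤ) ^ (padicValInt 2 S.c + 1) ∣ (e1CurveInt S).a₂ - (cmCurve ((S.B : ℤ) * S.C * S.b ^ S.n)).a₂ := by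
  refine ⟨rfl, rfl, rfl, rfl, ?_⟩
  show (2 : ℤ) ^ (padicValInt 2 S.c + 1) ∣ 2 * S.c * S.C - 0
  have h1 : (2 : ℤ) ^ padicValInt 2 S.c ∣ S.c := by exact_mod_cast padicValInt_dvd (p := 2) S.c
  rw [sub_zero, pow_succ]
  exact (mul_dvd_mul h1 (dvd_refl (2 : ℤ))).trans ⟨S.C, by ring⟩

/-- **Over `ℚ`, the quadratic twist of `E₀(D)` by `d` IS `E₀(d²·D)` on the nose**; in particular `E₀(9D)` is the twist of `E₀(D)` by `−3`
(and by `3`). With `ℚ₂(√−3)/ℚ₂` UNRAMIFIED (CITED), «`D ↦ 9D` = `⊗ μ`» (registrar l.111 P30(b)) is the DERIVED reading of this identity. -/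
theorem cmCurve_quadraticTwist (D d : ℚ) : (cmCurve D).quadraticTwist d = cmCurve (d ^ 2 * D) := by
  simp only [WeierstrassCurve.quadraticTwist, cmCurve, WeierstrassCurve.b₂, WeierstrassCurve.b₄, WeierstrassCurve.b₆,
    WeierstrassCurve.mk.injEq]
  exact ⟨by trivial, by ring, by trivial, by ring, by ring⟩

/-- **Over any commutative ring with a unit `u`, `u² = −3`: `E₀(9D) = ⟨u⁻¹, 0, 0, 0⟩ • E₀(D)`** (an isomorphism; e.g. over `K_v(√−3)`, the
unramified quadratic extension of `K_v = ℚ₂(i)` — CITED). -/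
theorem cmCurve_nine_eq_smul {R : Type*} [CommRing R] (u : Rˣ) (hu : (u : R) ^ 2 = -3) (D : R) :
    cmCurve (9 * D) = (⟨u⁻¹, 0, 0, 0⟩ : WeierstrassCurve.VariableChange R) • cmCurve D := by
  have hu4 : (u : R) ^ 4 = 9 := by rw [show (u : R) ^ 4 = ((u : R) ^ 2) ^ 2 by ring, hu]; norm_num
  rw [← L313QCurve.intScale_eq_smul u]
  ext <;> simp [cmCurve, L313QCurve.intScale, hu4]

/-- Over `ℚ`, the twist of `E₁(S)` by `−3` is `⟨0, −6cC, 0, 9D, 0⟩` (`E₁ ⊗ χ₋₃`: `2cC ↦ −3·2cC`, `D ↦ 9D`). -/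
theorem e1Curve_quadraticTwist_neg_three (S : FreyDatum) :
    ((e1CurveInt S).map (Int.castRingHom ℚ)).quadraticTwist (-3) =
      ⟨0, -3 * (2 * S.c * S.C : ℤ), 0, 9 * ((S.B : ℤ) * S.C * S.b ^ S.n : ℤ), 0⟩ := by
  simp only [WeierstrassCurve.quadraticTwist, WeierstrassCurve.map, e1CurveInt, WeierstrassCurve.b₂, WeierstrassCurve.b₄,
    WeierstrassCurve.b₆, eq_intCast, WeierstrassCurve.mk.injEq]
  push_cast
  exact ⟨by trivial, by ring, by trivial, by ring, by ring⟩

/-- Kernel table for registrar l.111 P30(b) («the bit FLIPS under `D ↦ 9D` … exactly HALF of the classes `b mod 16`»): for odd `b`,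
`D(9b) = B·(9b)²³ ≡ 9·B·b²³ = 9·D(b) (mod 16)`, and `b ↦ 9b` is a fixed-point-free involution of the odd residues mod `16`
(orbits `{1,9}, {3,11}, {5,13}, {7,15}`). Bookkeeping only; the bit itself is the hands' deliverable (G). -/
theorem zmod16_nine_table : ∀ b : ZMod 16, (∃ t : ZMod 16, b = 2 * t + 1) →
    (9 * b) ^ 23 = 9 * b ^ 23 ∧ 9 * (9 * b) = b ∧ 9 * b ≠ b := by
  decide

/-! ## (A4) The curve of record `E/ℚ(i)` at `v = (1+i)` -/

section QCurve

open L313QCurve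

/-- **`(1+i)`-adic factorizations of the invariants of `E`** (RECORD `L313QCurve`: `E_c₄ = ⟨−164112, −348480⟩`,
`E_c₆ = ⟨−258774912, 1178496⟩`, `E_Δ_val`): `c₄ = −(1+i)⁸·(10257 + 21780i)`, `c₆ = (1+i)¹⁵·(−1015443 − 1006236i)`,
`Δ = (1+i)¹²·(104841231443 − 133573677732i)`; all three cofactors have ODD norm. -/
theorem E_two_adic_factorizations :
    E.c₄ = -(1 + gi) ^ 8 * ⟨10257, 21780⟩ ∧ E.c₆ = (1 + gi) ^ 15 * ⟨-1015443, -1006236⟩ ∧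
      E.Δ = (1 + gi) ^ 12 * ⟨104841231443, -133573677732⟩ := by
  rw [E_c₄, E_c₆, E_Δ_val]
  refine ⟨?_, ?_, ?_⟩ <;> decide +kernel

/-- `1 + i` is prime in `ℤ[i]` (norm `2`; the place `v` of `ℚ(i)` above `2`, `K_v = ℚ₂(i)`, `e(K_v/ℚ₂) = 2`). -/
theorem one_add_gi_prime : Prime (1 + gi) :=
  (irreducible_of_norm_prime (by decide)).prime

/-- An element of `ℤ[i]` of odd norm is a `(1+i)`-adic unit. -/
theorem not_one_add_gi_dvd_of_norm_odd {z : GaussianInt} (hz : ¬ (2 : ℤ) ∣ z.norm) : ¬ (1 + gi) ∣ z := by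
  rintro ⟨w, rfl⟩
  rw [Zsqrtd.norm_mul, show (1 + gi).norm = 2 by decide] at hz
  exact hz (dvd_mul_right 2 _)

/-- **`(v(c₄), v(c₆), v(Δ))(E) = (8, 15, 12)` at `v = (1+i)`, exactly** (each as `(1+i)^e ∣ ·` and `(1+i)^{e+1} ∤ ·`). -/
theorem E_two_adic_valuations :
    ((1 + gi) ^ 8 ∣ E.c₄ ∧ ¬ (1 + gi) ^ 9 ∣ E.c₄) ∧ ((1 + gi) ^ 15 ∣ E.c₆ ∧ ¬ (1 + gi) ^ 16 ∣ E.c₆) ∧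
      ((1 + gi) ^ 12 ∣ E.Δ ∧ ¬ (1 + gi) ^ 13 ∣ E.Δ) := by
  obtain ⟨h4, h6, hΔ⟩ := E_two_adic_factorizations
  obtain ⟨hne, hw4⟩ : (1 + gi) ≠ 0 ∧ ¬ (1 + gi) ∣ ⟨10257, 21780⟩ := ⟨by decide, not_one_add_gi_dvd_of_norm_odd (by decide)⟩
  have hw6 : ¬ (1 + gi) ∣ ⟨-1015443, -1006236⟩ := not_one_add_gi_dvd_of_norm_odd (by decide)
  have hwΔ : ¬ (1 + gi) ∣ ⟨104841231443, -133573677732⟩ := not_one_add_gi_dvd_of_norm_odd (by decide)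
  refine ⟨⟨?_, fun h => hw4 ?_⟩, ⟨?_, fun h => hw6 ?_⟩, ⟨?_, fun h => hwΔ ?_⟩⟩
  · rw [h4]; exact Dvd.dvd.mul_right (dvd_neg.mpr dvd_rfl) _
  · rw [h4, pow_succ, neg_mul, dvd_neg] at h; exact (mul_dvd_mul_iff_left (pow_ne_zero 8 hne)).mp h
  · rw [h6]; exact dvd_mul_right _ _
  · rw [h6, pow_succ] at h; exact (mul_dvd_mul_iff_left (pow_ne_zero 15 hne)).mp h
  · rw [hΔ]; exact dvd_mul_right _ _
  · rw [hΔ, pow_succ] at h; exact (mul_dvd_mul_iff_left (pow_ne_zero 12 hne)).mp h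

/-- **`v(c₄³) = 24` and `v(Δ) = 12` at `v = (1+i)`, so `v(j(E)) = v(c₄³) − v(Δ) = 12 ≥ 0`: `j(E)` is integral at `v`** — hence `E` has
POTENTIALLY GOOD reduction at `v` ([Sil09, VII.5.5], CITED for this implication; THEORY §1), and `3 ∣ v(Δ) = 12` (the registrar's input for
«`3 ∤ e(E/K_v)`», ADDENDUM (T1)). Minimality at `v`, Kodaira `I₂*`, `f_v = 6` are the engines' CHECK X, NOT claimed here. -/
theorem E_two_adic_j : (1 + gi) ^ 24 ∣ E.c₄ ^ 3 ∧ ¬ (1 + gi) ^ 25 ∣ E.c₄ ^ 3 := by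
  refine ⟨?_, fun h => ?_⟩
  · simpa [← pow_mul] using pow_dvd_pow_of_dvd E_two_adic_valuations.1.1 3
  · obtain ⟨h4, -, -⟩ := E_two_adic_factorizations
    have hne : (1 + gi) ≠ 0 := by decide
    have hw : ¬ (1 + gi) ∣ (⟨10257, 21780⟩ : GaussianInt) ^ 3 := fun h3 =>
      not_one_add_gi_dvd_of_norm_odd (by decide) (one_add_gi_prime.dvd_of_dvd_pow h3)
    rw [h4, show (-(1 + gi) ^ 8 * (⟨10257, 21780⟩ : GaussianInt)) ^ 3 = (1 + gi) ^ 24 * (-⟨10257, 21780⟩ ^ 3) by ring,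
      pow_succ, dvd_neg.symm, mul_neg, neg_neg] at h
    exact hw ((mul_dvd_mul_iff_left (pow_ne_zero 24 hne)).mp h)

open Polynomial in
/-- **`Ψ₃(E) = 3X⁴ + 4a₂X³ + 6a₄X² − a₄²`** (Mathlib's 3-division polynomial of the model of record `E = [0, a₂, 0, a₄, 0]`): the hands'
input polynomial for `G₃(E) = Gal(K_v(E[3])/K_v)` (THEORY §3/§7). -/
theorem E_Ψ₃ : E.Ψ₃ = 3 * X ^ 4 + C (4 * a2) * X ^ 3 + C (6 * a4) * X ^ 2 - C (a4 ^ 2) := by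
  simp only [WeierstrassCurve.Ψ₃, WeierstrassCurve.b₂, WeierstrassCurve.b₄, WeierstrassCurve.b₆, WeierstrassCurve.b₈, E]
  simp only [map_add, map_mul, map_sub, map_pow, map_ofNat, map_zero]
  ring

end QCurve

open Polynomial in
/-- **`Ψ₃(E₁(S)) = 3X⁴ + 8cC·X³ + 6D·X² − D²`**, `D = BC·bⁿ` (Mathlib's 3-division polynomial): the hands' input polynomial for
`Gal(ℚ₂(i)(E₁[3])/ℚ₂(i)) ∈ {C₈, D₈}` (THEORY §7, deliverable (F)). -/
theorem e1CurveInt_Ψ₃ (S : FreyDatum) :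
    (e1CurveInt S).Ψ₃ = 3 * X ^ 4 + C (8 * S.c * (S.C : ℤ)) * X ^ 3 + C (6 * ((S.B : ℤ) * S.C * S.b ^ S.n)) * X ^ 2
      - C (((S.B : ℤ) * S.C * S.b ^ S.n) ^ 2) := by
  simp only [WeierstrassCurve.Ψ₃, WeierstrassCurve.b₂, WeierstrassCurve.b₄, WeierstrassCurve.b₆, WeierstrassCurve.b₈,
    e1CurveInt]
  simp only [map_add, map_mul, map_sub, map_pow, map_ofNat, map_zero]
  ring

end Summit.Ventures.AbcSig.Conjectures
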